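import Summits.CriticalPhenomena.PercolationContinuityZ3.Theorems.PercNearOneGluingNoHeavyLowerTailHullPortTANSections
import Summits.CriticalPhenomena.PercolationContinuityZ3.Theorems.PercNearOneGluingNoHeavyLowerTailHullPortTAInduction
import Summits.CriticalPhenomena.PercolationContinuityZ3.Theorems.PercNearOneGluingNoHeavyLowerTailHullPortPvHolds
import Summits.CriticalPhenomena.PercolationContinuityZ3.Theorems.PercNearOneGluingNoHeavyLowerTailQ7PsiSetObserverHalf
import HarnessLib

/-!
# `NoHeavyLowerTail` (stmt-CriticalPhenomena-4575) — set-observer `T_A ≥ 0`: Lemma 2 for a set and the double induction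

Support file (prover `prim-hp-7`; `--supports stmt-CriticalPhenomena-4575`); no definitions, named facts or sorries.
Part 2 of the Lean proof of the SET-OBSERVER version of prim-hp-7's `T_A ≥ 0` (blueprint step B2 of prim-cplus-coupling's
A5-COUPLING-gen13.md §5 towards Kozma–Nitzan's Question 9 at `|A| = 3`; refereed in prim-hp-7's
FROM-prim-hp-7-g29-REFEREE-MDLSET.md §1):
* `HullPort.lemma2N_avoidance` — the only observer-dependent inequality of the induction,
  `a^N_{X∪{v}} b_X ≤ a^N_X b_{X∪{v}}`: BHK's Theorem 1.3 for the cluster of `y` given `{y ↮ s, X}` against the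
  product of the increasing cluster event `{y ↔ N}` and the decreasing off-cluster event `{N ↮ s, X}`
  (`Q7Psi.setSep_offCluster_posCorrelation_event`, coupling seat), plus `{N ↮ s, X, v} ⊆ {N ↮ s, X}`;
* `HullPort.taQN_nonneg` — **`Q^N = A^N·b − a^N·B ≥ 0`** for all weights `< 1`, every avoided set `X`, every observer
  set `N`, every monotone `g ≥ 0`: the strong induction of `HullPort.taQ_nonneg_of_Pv` with `taAN_section`/`taaN_section`,
  `bernstein_step`, `lemma2N_avoidance`, and the OBSERVER-FREE `Δ̂_N ≥ 0` (`HullPort.deltaN_nonneg`, fed by the vertex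
  theorem `HullPort.taQ_nonneg_of_Pv` at the marker `v` and `HullPort.Pv_holds`).
[cite: VandenbergHaggstromKahn2005, Thm. 1.3 (p. 6), §1 pp. 7–8 — corollaries; Gladkov2024, Thm. 3.2 (via `Pv_holds`)]
[cite: KozmaNitzan2024, Question 9 (p. 36)]
-/

noncomputable section

namespace Summit.CriticalPhenomena.PercolationContinuityZ3.Theorems

open MeasureTheory Set Literature.Probability.LatticeModels Literature.Probability.Percolation
open scoped Classical

variable {V : Type*}

namespace HullPort

open LonePortSum LonePortSumGeneral BHK2006 DecisionTree KNPreFKG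

section TAN

variable [Fintype V]

/-! ### Lemma 2 for a set of observers -/

omit [Fintype V] in
/-- Separation events `{N ↮ T}` are decreasing. [folklore] -/
theorem isLowerSet_sepEv (N T : Set V) : IsLowerSet (sepEv N T : Set (Set (Sym2 V))) := by
  intro ω ω' hle hω n hn t ht hr
  exact hω n hn t ht (hr.mono (openGraph_le hle))

/-- **Lemma 2 for a set of observers (avoidance monotonicity)**:
`a^N_{X∪{v}} · b_X ≤ a^N_X · b_{X∪{v}}`, i.e. `μ(y ↔ N, N ↮ s,X,v | y ↮ s,X,v) ≤ μ(y ↔ N, N ↮ s,X | y ↮ s,X)`: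
given `{y ↮ s, X}` the cluster of `y` is positively associated (BHK Thm 1.3), `𝟙{v ∉ C_y}` is decreasing, and the
conditional weight of `{y ↔ N, N ↮ s, X}` given `C_y = J` is `1{J ∩ N ≠ ∅}·μ_{G−J}(N ∖ J ↮ s, X)`, increasing in `J`
(`Q7Psi.setSep_offCluster_posCorrelation_event`); the extra separation `{N ↮ v}` only removes configurations.
(cell memo prim-cplus-coupling A5-COUPLING-gen13.md §4 (4b); refereed in prim-hp-7 FROM-prim-hp-7-g29-REFEREE-MDLSET.md §1)
[cite: VandenbergHaggstromKahn2005, Thm. 1.3 (p. 6), §1 pp. 7–8 — corollary] -/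
theorem lemma2N_avoidance (p : Sym2 V → unitInterval) (s y : V) (N : Set V) (v : V) (X : Set V) (hsy : s ≠ y) :
    taaN (fun e => (p e : ℝ)) s y N (insert v X) * tab (fun e => (p e : ℝ)) s y X ≤
      taaN (fun e => (p e : ℝ)) s y N X * tab (fun e => (p e : ℝ)) s y (insert v X) := by
  classical
  set q : Sym2 V → ℝ := fun e => (p e : ℝ) with hq
  have hq0 : ∀ e, 0 ≤ q e := fun e => (p e).2.1
  have hq1 : ∀ e, q e ≤ 1 := fun e => (p e).2.2
  by_cases hyX : y ∈ X
  · have h0 : tab q s y X = 0 := tab_eq_zero_of_mem q s y X (Set.mem_insert_of_mem _ hyX)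
    have h0' : taaN q s y N X = 0 := taaN_eq_zero_of_mem q s y N X (Set.mem_insert_of_mem _ hyX)
    rw [h0, h0', mul_zero, zero_mul]
  set T : Set V := insert s X with hT
  have hyT : y ∉ T := by
    intro h
    rcases Set.mem_insert_iff.1 h with h | h
    · exact hsy h.symm
    · exact hyX h
  -- the cluster functions `χ = 1{v ∈ V(C_y)}`, `Φ = 1{N ∩ V(C_y) ≠ ∅}` and the off-cluster statistic `G = 1{N ↮ T}`
  set χ : Set (Sym2 V) → ℝ := fun C => if (v = y ∨ ∃ e ∈ C, v ∈ e) then 1 else 0 with hχ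
  set Φ : Set (Sym2 V) → ℝ := fun C => if (∃ n ∈ N, (n = y ∨ ∃ e ∈ C, n ∈ e)) then 1 else 0 with hΦ
  have hχmono : Monotone χ := by
    intro C C' hCC'
    simp only [hχ]
    by_cases h : (v = y ∨ ∃ e ∈ C, v ∈ e)
    · rw [if_pos h, if_pos (h.imp id fun ⟨e, he, hve⟩ => ⟨e, hCC' he, hve⟩)]
    · rw [if_neg h]; split_ifs <;> norm_num
  have hχle : ∀ C, χ C ≤ 1 := fun C => by simp only [hχ]; split_ifs <;> norm_num
  have hΦmono : Monotone Φ := by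
    intro C C' hCC'
    simp only [hΦ]
    by_cases h : ∃ n ∈ N, (n = y ∨ ∃ e ∈ C, n ∈ e)
    · have h' : ∃ n ∈ N, (n = y ∨ ∃ e ∈ C', n ∈ e) :=
        h.imp fun n ⟨hn, hc⟩ => ⟨hn, hc.imp id fun ⟨e, he, hne⟩ => ⟨e, hCC' he, hne⟩⟩
      rw [if_pos h, if_pos h']
    · rw [if_neg h]; split_ifs <;> norm_num
  have hΦ0 : ∀ C, 0 ≤ Φ C := fun C => by simp only [hΦ]; split_ifs <;> norm_num
  have hχeq : ∀ ω : BondConfig V, χ (openEdgeCluster ω y) = ind (openConn y v) ω := by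
    intro ω
    by_cases h : ω ∈ openConn y v
    · rw [ind_of_mem h, hχ]; simp only [if_pos ((reachable_iff_exists_mem_openEdgeCluster ω y v).1 h)]
    · rw [ind_of_not_mem h, hχ]
      have h' : ¬ (v = y ∨ ∃ e ∈ openEdgeCluster ω y, v ∈ e) := fun hh =>
        h ((reachable_iff_exists_mem_openEdgeCluster ω y v).2 hh)
      simp only [if_neg h']
  have hΦeq : ∀ ω : BondConfig V, Φ (openEdgeCluster ω y) = ind (connS N y) ω := by
    intro ω
    by_cases hω : ω ∈ connS N y
    · obtain ⟨n, hn, hr⟩ := hω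
      rw [ind_of_mem (show ω ∈ connS N y from ⟨n, hn, hr⟩), hΦ]
      simp only
      rw [if_pos ⟨n, hn, (reachable_iff_exists_mem_openEdgeCluster ω y n).1 hr⟩]
    · rw [ind_of_not_mem hω, hΦ]
      simp only
      rw [if_neg]
      rintro ⟨n, hn, hc⟩
      exact hω ⟨n, hn, (reachable_iff_exists_mem_openEdgeCluster ω y n).2 hc⟩
  set G : BondConfig V → ℝ := ind (sepEv N T) with hG
  have hGa : Antitone G := fun ξ ξ' h => ind_anti_of_isLowerSet (isLowerSet_sepEv N T) h
  have hG0 : ∀ ξ, 0 ≤ G ξ := fun ξ => ind_nonneg _ _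
  have hloc : ∀ ω : BondConfig V, (∀ x ∈ T, ¬ (openGraph ω).Reachable y x) →
      G (ω \ {e | ∃ u ∈ e, u = y ∨ ∃ e' ∈ openEdgeCluster ω y, u ∈ e'}) = G ω := by
    intro ω hω
    have key : (ω \ {e | ∃ u ∈ e, u = y ∨ ∃ e' ∈ openEdgeCluster ω y, u ∈ e'}) ∈ sepEv N T ↔ ω ∈ sepEv N T := by
      simp only [sepEv, Set.mem_setOf_eq]
      refine forall₂_congr fun n _ => forall₂_congr fun t ht => not_congr ?_
      rw [SimpleGraph.reachable_comm, reachable_sdiff_bar_iff (hω t ht) n, SimpleGraph.reachable_comm]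
    simp only [hG]
    by_cases h : ω ∈ sepEv N T
    · rw [ind_of_mem h, ind_of_mem (key.2 h)]
    · rw [ind_of_not_mem h, ind_of_not_mem (fun h' => h (key.1 h'))]
  have key := Q7Psi.setSep_offCluster_posCorrelation_event p y T hyT χ hχmono Φ hΦmono hΦ0 G hGa hG0 hloc
  have hD : {ω : BondConfig V | ∀ x ∈ T, ¬ (openGraph ω).Reachable y x} = avoidEv y T := rfl
  rw [hD, setIntegral_eq_sum p (avoidEv y T), setIntegral_eq_sum p (avoidEv y T),
    setIntegral_eq_sum p (avoidEv y T), measureReal_eq_sum p (avoidEv y T)] at key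
  -- the five sums
  have eb0 : tab q s y X = ∑ ω, weight q ω * ind (avoidEv y T) ω := rfl
  have ea0 : taaN q s y N X = ∑ ω, weight q ω * (Φ (openEdgeCluster ω y) * G ω * ind (avoidEv y T) ω) := by
    rw [taaN]
    refine Finset.sum_congr rfl fun ω _ => ?_
    rw [hΦeq ω, hG, ind_inter, ind_inter]
    ring
  have eb1 : tab q s y (insert v X) = (∑ ω, weight q ω * ind (avoidEv y T) ω) -
      ∑ ω, weight q ω * (χ (openEdgeCluster ω y) * ind (avoidEv y T) ω) := by
    rw [tab, ← Finset.sum_sub_distrib]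
    refine Finset.sum_congr rfl fun ω _ => ?_
    rw [avoidEv_insert_insert_eq, hχeq ω, ind_inter_compl]
    ring
  have ea1 : taaN q s y N (insert v X) ≤ (∑ ω, weight q ω * (Φ (openEdgeCluster ω y) * G ω * ind (avoidEv y T) ω)) -
      ∑ ω, weight q ω * (χ (openEdgeCluster ω y) * (Φ (openEdgeCluster ω y) * G ω) * ind (avoidEv y T) ω) := by
    rw [taaN, ← Finset.sum_sub_distrib]
    refine Finset.sum_le_sum fun ω _ => ?_
    rw [← mul_sub]
    refine mul_le_mul_of_nonneg_left ?_ (weight_nonneg hq0 hq1 ω)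
    rw [hχeq ω, hΦeq ω, hG]
    by_cases hω : ω ∈ avoidEv y (insert s (insert v X)) ∩ (connS N y ∩ sepEv N (insert s (insert v X)))
    · have hω' := hω
      obtain ⟨h1, h2, h3⟩ := hω'
      rw [avoidEv_insert_insert_eq] at h1
      have h3' : ω ∈ sepEv N T := fun n hn t ht => h3 n hn t (by
        rcases Set.mem_insert_iff.1 ht with rfl | ht
        · exact Set.mem_insert _ _
        · exact Set.mem_insert_of_mem _ (Set.mem_insert_of_mem _ ht))
      have h12 : ω ∉ openConn y v := h1.2
      rw [ind_of_mem hω, ind_of_mem h1.1, ind_of_not_mem h12, ind_of_mem h2, ind_of_mem h3']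
      norm_num
    · rw [ind_of_not_mem hω]
      have a1 := ind_nonneg (openConn y v : Set (BondConfig V)) ω
      have a2 := ind_le_one (openConn y v : Set (BondConfig V)) ω
      have a3 := ind_nonneg (connS N y : Set (Set (Sym2 V))) ω
      have a4 := ind_nonneg (sepEv N T : Set (Set (Sym2 V))) ω
      have a5 := ind_nonneg (avoidEv y T : Set (Set (Sym2 V))) ω
      have : 0 ≤ (1 - ind (openConn y v : Set (BondConfig V)) ω) := by linarith
      have h6 := mul_nonneg (mul_nonneg (mul_nonneg this a3) a4) a5
      linarith [h6]
  set b0 := ∑ ω, weight q ω * ind (avoidEv y T) ω with hb0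
  set Iχ := ∑ ω, weight q ω * (χ (openEdgeCluster ω y) * ind (avoidEv y T) ω) with hIχ
  set IΦG := ∑ ω, weight q ω * (Φ (openEdgeCluster ω y) * G ω * ind (avoidEv y T) ω) with hIΦG
  set IχΦG := ∑ ω, weight q ω * (χ (openEdgeCluster ω y) * (Φ (openEdgeCluster ω y) * G ω) * ind (avoidEv y T) ω)
    with hIχΦG
  have hb0nn : 0 ≤ b0 := Finset.sum_nonneg fun ω _ => mul_nonneg (weight_nonneg hq0 hq1 ω) (ind_nonneg _ _)
  rw [ea0, eb0, eb1]
  have h1 : taaN q s y N (insert v X) * b0 ≤ (IΦG - IχΦG) * b0 := mul_le_mul_of_nonneg_right ea1 hb0nn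
  nlinarith [h1, key]

/-! ### The induction -/

/-- **`T^N_A ≥ 0` in the form `Q^N = A^N·b − a^N·B ≥ 0`** — the SET-OBSERVER version of prim-hp-7's `T_A ≥ 0`
(`HullPort.taQ_nonneg_of_Pv`): for every weight vector with all weights `< 1`, every avoided set `X`, every observer set
`N`, and every monotone `g ≥ 0`.  Strong induction on `(|V ∖ X|, #{non-loop pairs of positive weight joining X to V ∖ X})`
verbatim as in the vertex case: base case `taQN_eq_zero_of_noBoundary`; in the step one boundary pair `e = {x₀, v}` is
resampled (`taAN_section`, `taaN_section`, `taB_section`, `tab_section`), the endpoints are the smaller states `(w[e↦0], X)`,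
`(w[e↦0], X ∪ {v})`, and `bernstein_step` closes with `lemma2N_avoidance` and the OBSERVER-FREE `Δ̂_N ≥ 0`
(`deltaN_nonneg`, fed by the vertex theorem `taQ_nonneg_of_Pv` with the marker `v` and Lemma `P_v` = `Pv_holds`).
(cell memos prim-hp-7 HP7-MDLX-PROOF.md §5, prim-cplus-coupling A5-COUPLING-gen13.md §4 (4a)–(4b))
[cite: VandenbergHaggstromKahn2005, Thm. 1.3 (p. 6) — corollaries; Gladkov2024, Thm. 3.2 (via `Pv_holds`)] -/
theorem taQN_nonneg (s y : V) (hsy : s ≠ y) (N : Set V) (g : Set (Sym2 V) → ℝ) (hg : Monotone g)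
    (hg0 : ∀ C, 0 ≤ g C) (w : Sym2 V → unitInterval) (hw : ∀ e, (w e : ℝ) < 1) (X : Set V) :
    0 ≤ taQN (fun e => (w e : ℝ)) s y N X g := by
  classical
  have hPv := Pv_holds s y g hg hg0
  set M : ℕ := Fintype.card (Sym2 V) with hM
  have main : ∀ (K : ℕ) (w : Sym2 V → unitInterval), (∀ e, (w e : ℝ) < 1) → ∀ (X : Set V),
      (Finset.univ.filter (fun u : V => u ∉ X)).card * (M + 1) +
        (Finset.univ.filter (fun e : Sym2 V => ¬ e.IsDiag ∧ (∃ a ∈ e, a ∈ X) ∧ (∃ b ∈ e, b ∉ X) ∧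
          0 < (w e : ℝ))).card = K → 0 ≤ taQN (fun e => (w e : ℝ)) s y N X g := by
    intro K
    induction K using Nat.strong_induction_on with
    | _ K ih =>
    intro w hw X hK
    set ŵ : Sym2 V → ℝ := fun e => (w e : ℝ) with hŵ
    have hw0 : ∀ e, 0 ≤ ŵ e := fun e => (w e).2.1
    have hw1 : ∀ e, ŵ e ≤ 1 := fun e => (w e).2.2
    have hm : ∑ ω, weight ŵ ω = 1 := by
      have h1 := integral_prodBernoulli_eq_sum w fun _ => (1 : ℝ)
      simp only [integral_const, probReal_univ, smul_eq_mul, mul_one] at h1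
      exact h1.symm
    set F : Finset (Sym2 V) := Finset.univ.filter (fun e : Sym2 V => ¬ e.IsDiag ∧ (∃ a ∈ e, a ∈ X) ∧
      (∃ b ∈ e, b ∉ X) ∧ 0 < (w e : ℝ)) with hF
    by_cases hF0 : F = ∅
    · have hbd : ∀ e : Sym2 V, ¬ e.IsDiag → ∀ a ∈ e, ∀ b ∈ e, a ∈ X → b ∉ X → ŵ e = 0 := by
        intro e hd a ha b hb haX hbX
        by_contra hne
        have hpos : 0 < (w e : ℝ) := lt_of_le_of_ne (hw0 e) (Ne.symm hne)
        have : e ∈ F := by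
          rw [hF, Finset.mem_filter]
          exact ⟨Finset.mem_univ _, hd, ⟨a, ha, haX⟩, ⟨b, hb, hbX⟩, hpos⟩
        rw [hF0] at this
        exact absurd this (Finset.notMem_empty _)
      rw [taQN_eq_zero_of_noBoundary ŵ hw0 hw1 hm s y N hsy X g hbd]
    · obtain ⟨e₀, he₀⟩ := Finset.nonempty_iff_ne_empty.2 hF0
      have he₀' := (Finset.mem_filter.1 he₀).2
      obtain ⟨hdiag, ⟨x₀, hx₀e, hx₀X⟩, ⟨v, hve, hvX⟩, hpos⟩ := he₀'
      have hx₀v : x₀ ≠ v := fun h => hvX (h ▸ hx₀X)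
      have he₀eq : e₀ = s(x₀, v) := (Sym2.mem_and_mem_iff hx₀v).1 ⟨hx₀e, hve⟩
      set w₀ : Sym2 V → unitInterval := Function.update w e₀ 0 with hw₀def
      set ŵ₀ : Sym2 V → ℝ := fun e => (w₀ e : ℝ) with hŵ₀
      have he0 : ŵ₀ s(x₀, v) = 0 := by
        simp only [hŵ₀, hw₀def, ← he₀eq, Function.update_self]; rfl
      have hoff : ∀ f, f ≠ s(x₀, v) → ŵ₀ f = ŵ f := by
        intro f hf
        simp only [hŵ₀, hw₀def, hŵ]
        rw [Function.update_of_ne (he₀eq ▸ hf)]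
      have hw₀lt : ∀ e, (w₀ e : ℝ) < 1 := by
        intro e
        by_cases h : e = e₀
        · subst h; simp only [hw₀def, Function.update_self]; norm_num
        · simp only [hw₀def, Function.update_of_ne h]; exact hw e
      have hK0 : (Finset.univ.filter (fun u : V => u ∉ X)).card * (M + 1) +
          (Finset.univ.filter (fun e : Sym2 V => ¬ e.IsDiag ∧ (∃ a ∈ e, a ∈ X) ∧ (∃ b ∈ e, b ∉ X) ∧
            0 < (w₀ e : ℝ))).card < K := by
        rw [← hK]
        apply Nat.add_lt_add_left
        apply Finset.card_lt_card
        refine ⟨fun f hf => ?_, fun hsub => ?_⟩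
        · rw [Finset.mem_filter] at hf ⊢
          obtain ⟨_, hd, ha, hb, hp⟩ := hf
          have hfe : f ≠ e₀ := by
            rintro rfl
            simp only [hw₀def, Function.update_self] at hp
            exact absurd hp (by norm_num)
          refine ⟨Finset.mem_univ _, hd, ha, hb, ?_⟩
          simpa only [hw₀def, Function.update_of_ne hfe] using hp
        · have := (Finset.mem_filter.1 (hsub he₀)).2.2.2.2
          simp only [hw₀def, Function.update_self] at this
          exact absurd this (by norm_num)
      have hK1 : (Finset.univ.filter (fun u : V => u ∉ insert v X)).card * (M + 1) +
          (Finset.univ.filter (fun e : Sym2 V => ¬ e.IsDiag ∧ (∃ a ∈ e, a ∈ insert v X) ∧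
            (∃ b ∈ e, b ∉ insert v X) ∧ 0 < (w₀ e : ℝ))).card < K := by
        rw [← hK]
        have hn : (Finset.univ.filter (fun u : V => u ∉ insert v X)).card + 1 ≤
            (Finset.univ.filter (fun u : V => u ∉ X)).card := by
          rw [Nat.add_one_le_iff]
          apply Finset.card_lt_card
          refine ⟨fun u hu => ?_, fun hsub => ?_⟩
          · rw [Finset.mem_filter] at hu ⊢
            exact ⟨hu.1, fun h => hu.2 (Set.mem_insert_of_mem _ h)⟩
          · have := (Finset.mem_filter.1 (hsub (Finset.mem_filter.2 ⟨Finset.mem_univ v, hvX⟩))).2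
            exact this (Set.mem_insert _ _)
        have hm' : (Finset.univ.filter (fun e : Sym2 V => ¬ e.IsDiag ∧ (∃ a ∈ e, a ∈ insert v X) ∧
            (∃ b ∈ e, b ∉ insert v X) ∧ 0 < (w₀ e : ℝ))).card ≤ M :=
          (Finset.card_le_univ _).trans (le_of_eq rfl)
        calc (Finset.univ.filter (fun u : V => u ∉ insert v X)).card * (M + 1) +
              (Finset.univ.filter (fun e : Sym2 V => ¬ e.IsDiag ∧ (∃ a ∈ e, a ∈ insert v X) ∧
                (∃ b ∈ e, b ∉ insert v X) ∧ 0 < (w₀ e : ℝ))).card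
            < (Finset.univ.filter (fun u : V => u ∉ insert v X)).card * (M + 1) + (M + 1) := by
              linarith
          _ = ((Finset.univ.filter (fun u : V => u ∉ insert v X)).card + 1) * (M + 1) := by ring
          _ ≤ (Finset.univ.filter (fun u : V => u ∉ X)).card * (M + 1) := Nat.mul_le_mul_right _ hn
          _ ≤ _ := Nat.le_add_right _ _
      -- induction hypotheses (observer set `N`) and the vertex theorem with the marker `v`
      have hQ00 : 0 ≤ taQN ŵ₀ s y N X g := ih _ hK0 w₀ hw₀lt X rfl
      have hQ11 : 0 ≤ taQN ŵ₀ s y N (insert v X) g := by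
        refine ih _ ?_ w₀ hw₀lt (insert v X) rfl
        convert hK1 using 6
      have hQv : 0 ≤ taQ ŵ₀ s y v X g := taQ_nonneg_of_Pv s y hsy g hPv w₀ hw₀lt X v
      -- the one-edge sections
      have sA := taAN_section ŵ ŵ₀ s y N x₀ v X hx₀X he0 hoff g
      have sB := taB_section ŵ ŵ₀ s y x₀ v X hx₀X he0 hoff g
      have sa := taaN_section ŵ ŵ₀ s y N x₀ v X hx₀X he0 hoff
      have sb := tab_section ŵ ŵ₀ s y x₀ v X hx₀X he0 hoff
      have ht0 : 0 ≤ ŵ s(x₀, v) := hw0 _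
      have ht1 : ŵ s(x₀, v) ≤ 1 := hw1 _
      rw [taQN, sA, sB, sa, sb]
      have hL2 := lemma2N_avoidance w₀ s y N v X hsy
      have hΔ := deltaN_nonneg w₀ hw₀lt s y v X g hPv hQv
      rw [taQN] at hQ00 hQ11
      by_cases hyv : y ∈ insert v X
      · have hA1 := taAN_eq_zero_of_mem ŵ₀ s y N hsy (insert v X) hyv g
        have hB1 := taB_eq_zero_of_mem ŵ₀ s y hsy (insert v X) hyv g
        have ha1 := taaN_eq_zero_of_mem ŵ₀ s y N (insert v X) (Set.mem_insert_of_mem _ hyv)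
        have hb1 := tab_eq_zero_of_mem ŵ₀ s y (insert v X) (Set.mem_insert_of_mem _ hyv)
        exact bernstein_step_degenerate _ _ _ _ _ _ _ _ (ŵ s(x₀, v)) hQ00 hA1 hB1 ha1 hb1
      · have hyX : y ∉ insert s X := by
          intro h
          rcases Set.mem_insert_iff.1 h with h | h
          · exact hsy h.symm
          · exact hyv (Set.mem_insert_of_mem _ h)
        have hyvX : y ∉ insert s (insert v X) := by
          intro h
          rcases Set.mem_insert_iff.1 h with h | h
          · exact hsy h.symm
          · exact hyv h
        have hw₀0 : ∀ e, 0 ≤ ŵ₀ e := fun e => (w₀ e).2.1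
        have hb0 := tab_pos ŵ₀ hw₀0 hw₀lt s y X hyX
        have hb1 := tab_pos ŵ₀ hw₀0 hw₀lt s y (insert v X) hyvX
        exact bernstein_step _ _ _ _ _ _ _ _ (ŵ s(x₀, v)) ht0 ht1 hQ00 hQ11 hΔ (by linarith [hL2]) hb0 hb1
  exact main _ w hw X rfl


end TAN

end HullPort

end Summit.CriticalPhenomena.PercolationContinuityZ3.Theorems
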